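import Mathlib
import HarnessLib
import Literature.MathematicalPhysics.QuantumFieldTheory.ConstructiveQFTWave0
import Literature.MathematicalPhysics.QuantumFieldTheory.ConstructiveQFTWave0Proofs
import Summits.Ventures.LatticeQCDFlow.Scaling.LatticeEntropy
import Summits.Ventures.LatticeQCDFlow.Scaling.LatticeComb

/-!
# LatticeQCDFlow / Scaling — tree (comb) gauge fixing and the small-ball bound with the sharp exponent

HONEST FRAMING: exact (Metropolis-corrected) sampling algorithms for lattice gauge theory;
figures of merit are autocorrelation/cost numbers at stated couplings and volumes; no
continuum-physics claim.

Venture `LatticeQCDFlow` (cell pub-lqcd), topic `Scaling`, THEORY-2.md §3.2 v2.1 / §4 row T2-AH(c′)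
(theory seat GEN-10, R-T2-10).  This file PROVES the typed item
`Summit.Ventures.LatticeQCDFlow.Theory2.Lattice.TreeGaugeSmallBallBound` of
`Scaling/LatticeEntropy.lean`: for the Wilson theory of a continuous matrix representation `ρ` of a
compact second-countable group `G` with `Re tr ρ ≤ N` on the torus `(ℤ/L)^d`, `β ≥ 0`, a measurable
`B ⊆ G` and `s` bounding the plaquette action on four-fold products from `insert 1 (B ∪ B⁻¹)`,

  `Haar(B)^(#E − (#V − 1)) · exp(−β·s·#P) ≤ Z_Λ(β)`,

i.e. the small-ball lower bound of `smallBallBound` with the exponent lowered from the number of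
links `#E = d·L^d` to the number of links OFF a spanning tree, `#E − (#V − 1)`.  This is what makes
the lower entropy bound of `EntropyGrowth` sharp to leading order (`(d−1)·V` instead of `d·V`
transverse degrees of freedom per `dim G`; companion file `Scaling/LatticeEntropyGrowthSharp.lean`).

THE PROOF (tree / comb / axial gauge, Creutz, *Quarks, gluons and lattices* (1983) Ch. 9;
Seiler LNP 159 (1982) Ch. 2; Chatterjee arXiv:1602.01222 §9 Lemma 9.3):

* §1–2 (companion file `Scaling/LatticeComb.lean`) the **comb** `treeEdges`: the edge `(x, i)` belongs to the comb iff `x_j = 0` for all `j < i` and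
  it does not wrap (`x_i + 1 < L`); `head e = x + e_i`.  Every site `x ≠ 0` is the head of a comb
  edge (`exists_mem_treeEdges_head_eq`: lower the first non-zero coordinate), so `#V − 1 ≤ #comb`
  (`card_site_sub_one_le_card_treeEdges`); two comb edges with the same head are equal, and a comb
  edge starting at the head of the comb edge `a` has `rank = rank a + 1`, where
  `rank e = Σ_j (head e)_j` (`free_of_max`: among comb edges of rank `≤ rank a`, none other than
  `a` touches `head a`).
* §2–3 the **one-link lemma** `lintegral_eq_lintegral_update_one`: if a measurable
  `F : G^E → [0, ∞]` is invariant under the gauge transformations supported at the single site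
  `head e₀ ≠ tail e₀`, then `∫ F dHaar^{⊗E} = ∫ F(U[e₀ ↦ 1]) dHaar^{⊗E}` — integrate the `e₀`
  variable first (a marginal), swap (Tonelli), and for fixed `g` undo `U_{e₀} = g` by the gauge
  transformation `γ = δ_{head e₀}^g`, which sends `U[e₀ ↦ g]` to `(U^γ)[e₀ ↦ 1]` and preserves
  product Haar measure (the tree's `WilsonGauge.measurePreserving_gaugeTransform`, `ConstructiveQFTWave0Proofs`).
* §3 **gauge fixing** `lintegral_weight_eq_lintegral_weight_fixOne`: by induction over the comb in
  the order of `rank` (`Finset.induction_on_max_value`), `∫ e^{−βS(U)} = ∫ e^{−βS(U[T ↦ 1])}` for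
  every set `T` of comb edges — the Wilson weight composed with "set the already-fixed links to 1"
  stays invariant under gauge transformations at the head of the next (maximal-rank) comb edge,
  because that head touches no already-fixed link.
* §4 restrict to the event "every link off the comb lies in `B`" (product measure `Haar(B)^{#Eᶜ}`),
  on which the gauge-fixed configuration has all links in `insert 1 B` and action `≤ s·#P`, and
  compare exponents (`Haar(B) ≤ 1`, `#(E ∖ comb) ≤ #E − (#V − 1)`).

Everything is proved, `[folklore]` level, no `sorry`; no definition of the venture is changed.
-/

noncomputable section

open MeasureTheory Function Literature.MathematicalPhysics.QuantumFieldTheory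
open scoped ENNReal

namespace Summit.Ventures.LatticeQCDFlow.Theory2.Lattice

/-! ## 3. Measure theory: the one-link lemma and gauge fixing under product Haar measure -/

section Marginal

variable {ι : Type*} [DecidableEq ι] {X : ι → Type*} [∀ i, MeasurableSpace (X i)]

/-- The `s`-marginal with respect to probability measures is idempotent. [folklore] -/
theorem lmarginal_lmarginal_self (μ : ∀ i, Measure (X i)) [∀ i, IsProbabilityMeasure (μ i)]
    (s : Finset ι) (f : (∀ i, X i) → ℝ≥0∞) :
    (∫⋯∫⁻_s, (∫⋯∫⁻_s, f ∂μ) ∂μ) = ∫⋯∫⁻_s, f ∂μ := by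
  funext x
  rw [lmarginal]
  have h : ∀ y : ∀ i : ↥s, X i, (∫⋯∫⁻_s, f ∂μ) (updateFinset x s y) = (∫⋯∫⁻_s, f ∂μ) x :=
    fun y => lmarginal_congr (μ := μ) f fun i hi => by simp [updateFinset, hi]
  simp_rw [h]
  rw [lintegral_const, measure_univ, mul_one]

end Marginal

section Haar

variable {d L N : ℕ} {G : Type*} [Group G] [TopologicalSpace G] [IsTopologicalGroup G]
  [CompactSpace G] [MeasurableSpace G] [BorelSpace G]

omit [TopologicalSpace G] [IsTopologicalGroup G] [CompactSpace G] [BorelSpace G] in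
/-- `fixOne s` is measurable. [folklore] -/
theorem measurable_fixOne (s : Finset (Edge d L)) :
    Measurable (fixOne s : GaugeConfig d L G → GaugeConfig d L G) := by
  refine measurable_pi_lambda _ fun e => ?_
  by_cases he : e ∈ s
  · simp only [fixOne, he, if_true]
    exact measurable_const
  · simp only [fixOne, he, if_false]
    exact measurable_pi_apply e

/-- **One-link lemma.** A measurable `F ≥ 0` on configurations which is invariant under the gauge
transformations supported at the head `x ≠ tail` of a link `e₀` has the same product-Haar integral
as `U ↦ F(U[e₀ ↦ 1])`: integrate `U_{e₀} = g` first, and undo it by the gauge transformation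
`δ_x^g`, which preserves product Haar measure. [folklore] -/
theorem lintegral_eq_lintegral_update_one [NeZero L] (F : GaugeConfig d L G → ℝ≥0∞)
    (hF : Measurable F) (e₀ : Edge d L) (hne : head e₀ ≠ e₀.1)
    (hinv : ∀ γ : Site d L → G, (∀ z, z ≠ head e₀ → γ z = 1) →
      ∀ U, F (gaugeTransform γ U) = F U) :
    ∫⁻ U, F U ∂(Measure.pi fun _ : Edge d L => haarProbability G) =
      ∫⁻ U, F (update U e₀ 1) ∂(Measure.pi fun _ : Edge d L => haarProbability G) := by
  classical
  have hupd : Measurable fun U : GaugeConfig d L G => F (update U e₀ 1) :=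
    hF.comp measurable_update_left
  -- (A) integrate the `e₀` variable first
  have hH : Measurable (∫⋯∫⁻_{e₀}, F ∂fun _ : Edge d L => haarProbability G) :=
    hF.lmarginal (fun _ : Edge d L => haarProbability G)
  have hA : ∫⁻ U, F U ∂(Measure.pi fun _ : Edge d L => haarProbability G) =
      ∫⁻ U, (∫⋯∫⁻_{e₀}, F ∂fun _ : Edge d L => haarProbability G) U
        ∂(Measure.pi fun _ : Edge d L => haarProbability G) :=
    lintegral_eq_of_lmarginal_eq {e₀} hF hH
      (lmarginal_lmarginal_self (fun _ : Edge d L => haarProbability G) {e₀} F).symm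
  have hA' : ∫⁻ U, F U ∂(Measure.pi fun _ : Edge d L => haarProbability G) =
      ∫⁻ U, ∫⁻ g, F (update U e₀ g) ∂(haarProbability G)
        ∂(Measure.pi fun _ : Edge d L => haarProbability G) := by
    rw [hA]
    simp only [lmarginal_singleton]
  -- (B) Tonelli
  have hmeas : Measurable (uncurry fun (U : GaugeConfig d L G) (g : G) => F (update U e₀ g)) :=
    hF.comp measurable_update'
  have hB : ∫⁻ U, ∫⁻ g, F (update U e₀ g) ∂(haarProbability G)
        ∂(Measure.pi fun _ : Edge d L => haarProbability G) =
      ∫⁻ g, ∫⁻ U, F (update U e₀ g) ∂(Measure.pi fun _ : Edge d L => haarProbability G)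
        ∂(haarProbability G) :=
    lintegral_lintegral_swap hmeas.aemeasurable
  -- (C) for fixed `g`, undo `U_{e₀} = g` by the gauge transformation `δ_x^g`
  have hC : ∀ g : G, ∫⁻ U, F (update U e₀ g) ∂(Measure.pi fun _ : Edge d L => haarProbability G) =
      ∫⁻ U, F (update U e₀ 1) ∂(Measure.pi fun _ : Edge d L => haarProbability G) := by
    intro g
    let γ : Site d L → G := fun z => if z = head e₀ then g else 1
    have h1 : γ e₀.1 = 1 := by
      show (if e₀.1 = head e₀ then g else 1) = 1
      exact if_neg hne.symm
    have h2 : γ (head e₀) = g := by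
      show (if head e₀ = head e₀ then g else 1) = g
      exact if_pos rfl
    have hγ1 : ∀ z, z ≠ head e₀ → γ z = 1 := fun z hz => by
      show (if z = head e₀ then g else 1) = 1
      exact if_neg hz
    calc ∫⁻ U, F (update U e₀ g) ∂(Measure.pi fun _ : Edge d L => haarProbability G)
        = ∫⁻ U, F (gaugeTransform γ (update U e₀ g))
            ∂(Measure.pi fun _ : Edge d L => haarProbability G) := by
          simp_rw [hinv γ hγ1]
      _ = ∫⁻ U, F (update (gaugeTransform γ U) e₀ 1)
            ∂(Measure.pi fun _ : Edge d L => haarProbability G) := by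
          simp_rw [gaugeTransform_update e₀ γ g h1 h2]
      _ = ∫⁻ U, F (update U e₀ 1) ∂(Measure.pi fun _ : Edge d L => haarProbability G) :=
          (WilsonGauge.measurePreserving_gaugeTransform γ).lintegral_comp hupd
  -- (D) assemble
  rw [hA', hB]
  simp_rw [hC]
  rw [lintegral_const, measure_univ, mul_one]

variable (ρ : G →* Matrix (Fin N) (Fin N) ℂ)

omit [CompactSpace G] [MeasurableSpace G] [BorelSpace G] in
/-- The Wilson action is continuous in the configuration (continuous `ρ`); same statement as
`continuous_wilsonAction` of package file #15 `Scaling/LatticeGibbs.lean`, kept under a distinct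
name so that both files can be imported together. [folklore] -/
theorem wilsonAction_continuous [NeZero L] (hρ : Continuous (ρ : G → Matrix (Fin N) (Fin N) ℂ)) :
    Continuous fun U : GaugeConfig d L G => wilsonAction ρ U := by
  unfold wilsonAction
  refine continuous_finsetSum _ fun p _ => ?_
  have h1 : Continuous fun U : GaugeConfig d L G => plaquetteHolonomy U p.1 p.2.1.1 p.2.1.2 := by
    unfold plaquetteHolonomy
    fun_prop
  exact continuous_const.sub (Complex.continuous_re.comp (hρ.comp h1).matrix_trace)

omit [CompactSpace G] in
/-- The Wilson weight `exp(−β S)` is measurable (continuous `ρ`, second-countable `G`). [folklore] -/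
theorem measurable_weight [SecondCountableTopology G] [NeZero L]
    (hρ : Continuous (ρ : G → Matrix (Fin N) (Fin N) ℂ)) (β : ℝ) :
    Measurable fun U : GaugeConfig d L G => ENNReal.ofReal (Real.exp (-β * wilsonAction ρ U)) :=
  (Real.continuous_exp.comp (continuous_const.mul (wilsonAction_continuous ρ hρ))).measurable.ennreal_ofReal

/-- **Gauge fixing on the comb.** For every set `s` of comb edges,
`∫ exp(−β S(U)) dHaar^{⊗E} = ∫ exp(−β S(U[s ↦ 1])) dHaar^{⊗E}`: remove a comb edge of maximal
rank by the one-link lemma — its head touches no other edge of `s` — and recurse. [folklore] -/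
theorem lintegral_weight_eq_lintegral_weight_fixOne [SecondCountableTopology G] [NeZero L]
    (hρ : Continuous (ρ : G → Matrix (Fin N) (Fin N) ℂ)) (β : ℝ) (s : Finset (Edge d L))
    (hs : ∀ e ∈ s, e ∈ treeEdges d L) :
    ∫⁻ U, ENNReal.ofReal (Real.exp (-β * wilsonAction ρ U))
        ∂(Measure.pi fun _ : Edge d L => haarProbability G) =
      ∫⁻ U, ENNReal.ofReal (Real.exp (-β * wilsonAction ρ (fixOne s U)))
        ∂(Measure.pi fun _ : Edge d L => haarProbability G) := by
  classical
  revert hs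
  refine Finset.induction_on_max_value (fun e : Edge d L => rank e) s ?_ ?_
  · intro _
    simp
  · intro a s has hmax ih hins
    have ha : a ∈ treeEdges d L := hins a (Finset.mem_insert_self a s)
    have hs : ∀ b ∈ s, b ∈ treeEdges d L := fun b hb => hins b (Finset.mem_insert_of_mem hb)
    have hfree : ∀ b ∈ s, b.1 ≠ head a ∧ head b ≠ head a := fun b hb =>
      free_of_max ha (hs b hb) (fun h => has (h ▸ hb)) (hmax b hb)
    have hF : Measurable fun U : GaugeConfig d L G =>
        ENNReal.ofReal (Real.exp (-β * wilsonAction ρ (fixOne s U))) :=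
      (measurable_weight ρ hρ β).comp (measurable_fixOne s)
    have hinv : ∀ γ : Site d L → G, (∀ z, z ≠ head a → γ z = 1) → ∀ U : GaugeConfig d L G,
        ENNReal.ofReal (Real.exp (-β * wilsonAction ρ (fixOne s (gaugeTransform γ U)))) =
          ENNReal.ofReal (Real.exp (-β * wilsonAction ρ (fixOne s U))) := by
      intro γ hγ U
      rw [fixOne_gaugeTransform s hfree γ hγ U, wilsonAction_gaugeTransform]
    calc ∫⁻ U, ENNReal.ofReal (Real.exp (-β * wilsonAction ρ U))
          ∂(Measure.pi fun _ : Edge d L => haarProbability G)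
        = ∫⁻ U, ENNReal.ofReal (Real.exp (-β * wilsonAction ρ (fixOne s U)))
            ∂(Measure.pi fun _ : Edge d L => haarProbability G) := ih hs
      _ = ∫⁻ U, ENNReal.ofReal (Real.exp (-β * wilsonAction ρ (fixOne s (update U a 1))))
            ∂(Measure.pi fun _ : Edge d L => haarProbability G) :=
          lintegral_eq_lintegral_update_one _ hF a (head_ne_fst ha) hinv
      _ = ∫⁻ U, ENNReal.ofReal (Real.exp (-β * wilsonAction ρ (fixOne (insert a s) U)))
            ∂(Measure.pi fun _ : Edge d L => haarProbability G) := by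
          simp_rw [fixOne_update]

/-- The product Haar measure of "every link off `T` lies in `B`" is `Haar(B)^{#Tᶜ}`. [folklore] -/
theorem pi_offSet_eq [NeZero L] (T : Finset (Edge d L)) (B : Set G) :
    (Measure.pi fun _ : Edge d L => haarProbability G)
        (Set.pi Set.univ fun e => if e ∈ T then Set.univ else B) =
      haarProbability G B ^ Tᶜ.card := by
  classical
  rw [Measure.pi_pi]
  have h : ∀ e : Edge d L, haarProbability G (if e ∈ T then Set.univ else B) =
      if e ∈ T then 1 else haarProbability G B := by
    intro e
    split_ifs <;> simp
  simp_rw [h]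
  rw [Finset.prod_ite, Finset.prod_const_one, one_mul, Finset.prod_const]
  congr 1
  congr 1
  ext e
  simp

/-! ## 4. `TreeGaugeSmallBallBound` holds -/

/-- **T2-AH(c′) TREE-GAUGE SMALL BALLS** — `TreeGaugeSmallBallBound d` holds:
`Haar(B)^(#E − (#V − 1)) · exp(−β·s·#P) ≤ Z_Λ(β)`.  Gauge-fix the comb (§3), restrict to the event
that every link off the comb lies in `B`, bound the action of the gauge-fixed configuration by
`s·#P`, and compare exponents. [folklore] -/
theorem treeGaugeSmallBallBound (d : ℕ) : TreeGaugeSmallBallBound d := by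
  intro N G _ _ _ _ _ _ _ ρ hρ htr L _ β hβ B hB s hs
  classical
  have hTtree : ∀ e ∈ treeEdges d L, e ∈ treeEdges d L := fun e he => he
  -- the event: every link off the comb lies in `B`
  have hCm : ∀ e : Edge d L, MeasurableSet (if e ∈ treeEdges d L then (Set.univ : Set G) else B) :=
    fun e => by split_ifs; exacts [MeasurableSet.univ, hB]
  have hAm : MeasurableSet
      (Set.pi Set.univ fun e : Edge d L => if e ∈ treeEdges d L then (Set.univ : Set G) else B) :=
    MeasurableSet.univ_pi hCm
  -- on the event, the gauge-fixed configuration has small action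
  have hS : ∀ U ∈ Set.pi Set.univ
      (fun e : Edge d L => if e ∈ treeEdges d L then (Set.univ : Set G) else B),
      wilsonAction ρ (fixOne (treeEdges d L) U) ≤ s * Fintype.card (Plaquette d L) := by
    intro U hU
    have hUB : ∀ e, e ∉ treeEdges d L → U e ∈ B := fun e he => by
      have h := hU e (Set.mem_univ e)
      simp only [he, if_false] at h
      exact h
    refine wilsonAction_le_of_mem ρ hs _ (fun e => ?_) (fun e => ?_)
    · by_cases he : e ∈ treeEdges d L
      · simp [fixOne, he]
      · simp only [fixOne, he, if_false]
        exact Set.mem_insert_of_mem _ (Set.mem_union_left _ (hUB e he))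
    · by_cases he : e ∈ treeEdges d L
      · simp [fixOne, he]
      · simp only [fixOne, he, if_false]
        exact Set.mem_insert_of_mem _ (Set.mem_union_right _ (Set.inv_mem_inv.mpr (hUB e he)))
  -- the `ℝ≥0∞` inequality with exponent `#(comb)ᶜ`
  have hZ : ENNReal.ofReal (Real.exp (-(β * s * Fintype.card (Plaquette d L)))) *
      haarProbability G B ^ (treeEdges d L)ᶜ.card ≤ partitionFunction (d := d) (L := L) ρ β := by
    unfold partitionFunction wilsonWeight
    rw [withDensity_apply _ MeasurableSet.univ, Measure.restrict_univ,
      lintegral_weight_eq_lintegral_weight_fixOne ρ hρ β (treeEdges d L) hTtree,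
      ← pi_offSet_eq (treeEdges d L) B, ← lintegral_indicator_const hAm]
    refine lintegral_mono fun U => ?_
    by_cases hU : U ∈ Set.pi Set.univ
        (fun e : Edge d L => if e ∈ treeEdges d L then (Set.univ : Set G) else B)
    · rw [Set.indicator_of_mem hU]
      refine ENNReal.ofReal_le_ofReal (Real.exp_le_exp.mpr ?_)
      have h1 := hS U hU
      have h2 : β * wilsonAction ρ (fixOne (treeEdges d L) U) ≤
          β * (s * Fintype.card (Plaquette d L)) := mul_le_mul_of_nonneg_left h1 hβ
      linarith
    · rw [Set.indicator_of_notMem hU]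
      exact zero_le
  -- exponents: `#(comb)ᶜ ≤ #E − (#V − 1)` and `Haar(B) ≤ 1`
  have hcard : (treeEdges d L)ᶜ.card ≤ Fintype.card (Edge d L) - (Fintype.card (Site d L) - 1) := by
    rw [Finset.card_compl]
    have := card_site_sub_one_le_card_treeEdges (d := d) (L := L)
    omega
  have hle1 : (haarProbability G B).toReal ≤ 1 :=
    ENNReal.toReal_le_of_le_ofReal zero_le_one (ENNReal.ofReal_one.symm ▸ prob_le_one)
  have hpow : (haarProbability G B).toReal ^
      (Fintype.card (Edge d L) - (Fintype.card (Site d L) - 1)) ≤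
        (haarProbability G B).toReal ^ (treeEdges d L)ᶜ.card :=
    pow_le_pow_of_le_one ENNReal.toReal_nonneg hle1 hcard
  -- pass to real numbers
  have hfin : partitionFunction (d := d) (L := L) ρ β ≠ ⊤ :=
    ne_top_of_le_ne_top ENNReal.one_ne_top (partitionFunction_le_one ρ htr hβ)
  have hlhs : (ENNReal.ofReal (Real.exp (-(β * s * Fintype.card (Plaquette d L)))) *
      haarProbability G B ^ (treeEdges d L)ᶜ.card).toReal =
      (haarProbability G B).toReal ^ (treeEdges d L)ᶜ.card *
        Real.exp (-(β * s * Fintype.card (Plaquette d L))) := by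
    rw [ENNReal.toReal_mul, ENNReal.toReal_pow, ENNReal.toReal_ofReal (Real.exp_nonneg _), mul_comm]
  calc (haarProbability G B).toReal ^ (Fintype.card (Edge d L) - (Fintype.card (Site d L) - 1)) *
        Real.exp (-(β * s * Fintype.card (Plaquette d L)))
      ≤ (haarProbability G B).toReal ^ (treeEdges d L)ᶜ.card *
          Real.exp (-(β * s * Fintype.card (Plaquette d L))) :=
        mul_le_mul_of_nonneg_right hpow (Real.exp_nonneg _)
    _ = (ENNReal.ofReal (Real.exp (-(β * s * Fintype.card (Plaquette d L)))) *
          haarProbability G B ^ (treeEdges d L)ᶜ.card).toReal := hlhs.symm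
    _ ≤ (partitionFunction (d := d) (L := L) ρ β).toReal :=
        (ENNReal.toReal_le_toReal (ENNReal.mul_ne_top ENNReal.ofReal_ne_top
          (ENNReal.pow_ne_top (measure_ne_top _ _))) hfin).mpr hZ

end Haar

end Summit.Ventures.LatticeQCDFlow.Theory2.Lattice
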